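import Mathlib
import HarnessLib
import Summits.ValiantsHypothesis.ValiantsHypothesis.Theorems.LacunarySymmetroidMatrixDescartesProductPlusOneCloudMonotone

/-!
# LINE (A) `product_plus_one` (crux `MatrixDescartes`, stmt-ValiantsHypothesis-18050, V1) — W-CB, the SLOW-KNEE CLOUD CELL, part (E4a):
# the rows of the cell in the variable `y = x^p` — binomial rows are KERNEL terms, cloud rows a CONVEX NON-DECREASING `G`

Owner memo `pub/ideators/val-idea-25/NOTE-idea25g3-18050-LINEA-AB-reduction.md` §19.1 (val-idea-25 g4; scratch19 `SlowKneeCloudCellK3`, route «substitute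
`y = x^r`»).  Vocabulary of ✓ `…CloudDefs` (`p = e₁+1`, `q = e₁+e₂+2`, row `A − Bx^p − Cx^q`, `ψ_k = rowPsi_k`; ✓ `logWronskian_row_eq_rowPsi1`:
`W(f)(x) = −f(x)²·ψ₁(x)`).  With `y = x^p`, i.e. `x = y^{1/p}` (`Real.rpow`, exponent `((e₁+1 : ℕ) : ℝ)⁻¹`):

* §1 `rowPsi1_binomial_eq` — a BINOMIAL row (`C = 0`, `B ≠ 0`) has `ψ₁(x) = p²·ρ·y/(y − ρ)²`, `ρ = A/B` (slow knee `B < 0 < A`: `ρ < 0`; switched puller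
  `0 < A`, `0 < B`, `y > ρ`: `0 < ρ`) — a term of ✓ `rootKernel…`'s kernel with weight `p²`;
* §2 the window transport `y ↦ y^{1/p}` (`rpow_inv_mem_Ioo`, `pow_mem_Ioo_pow`, `rpow_inv_natCast_pow'`);
* §3 ONE CLOUD ROW as a function of `y`: `G(y) = ψ₁(y^{1/p})/(p²y)` has `HasDerivAt G ((ψ₂ − pψ₁)(y^{1/p})/(p³y²)) y` (`hasDerivAt_cloudTerm`); the derivative is
  `≥ 0` where `p·ψ₁ ≤ ψ₂` (`cloudTerm_deriv_nonneg`) and NON-DECREASING on `(u^p, v^p)` where `3p·ψ₂ ≤ ψ₃ + 2p²·ψ₁` on `(u,v)` (`cloudTerm_deriv_monotoneOn`: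
  `d/dx[(ψ₂ − pψ₁)/x^{2p}] = (ψ₃ − 3pψ₂ + 2p²ψ₁)/x^{2p+1}`, then compose with the monotone `y ↦ y^{1/p}`) — the two TOWER INEQUALITIES are exactly
  (E2) `CloudConvexity` (val-lit-p8 g16's file) and enter here as hypotheses;
* §4 a finite CLOUD: `hasDerivAt_cloudSum`, `cloudSum_deriv_nonneg`, `cloudSum_deriv_monotoneOn` (sums over a finset of rows).

Part (E4b) `…SlowKneeCloudCell` assembles: ✓ `logWronskian_prod_eq_rowPsi1_sum` + §1 + §4 + ✓ `kernelPlusConvex_inner_no_three_zeros` (E1).  Honest framing: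
calculus of one cell; NOT `WronskianBudgetK3` / `OneChangeFloorK3` / `stub_classRowK3` / `stub_polyLaw` / `MatrixDescartes` / B; `VP ≠ VNP` NOT proved.
No definitions, no named facts; Mathlib + ✓ `…CloudDefs` / `…CloudCalculus` / `…CloudMonotone` only.
-/

set_option linter.dupNamespace false

namespace Summit.ValiantsHypothesis.ValiantsHypothesis.Theorems.LacunarySymmetroidMatrixDescartes

namespace ProductPlusOne

open Finset Set
open scoped BigOperators Topology

/-! ### §1 Binomial rows are kernel terms -/

/-- **A binomial row's slope is a kernel term**: for `C = 0`, `B ≠ 0` and `A − Bx^p ≠ 0`,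
`rowPsi1 e₁ e₂ A B 0 x = p²·(ρ·y/(y − ρ)²)` with `y = x^p`, `ρ = A/B`. [this file's lemma] -/
theorem rowPsi1_binomial_eq (e₁ e₂ : ℕ) (A B : ℝ) (hB : B ≠ 0) {x : ℝ} (hF : A - B * x ^ (e₁ + 1) ≠ 0) :
    rowPsi1 e₁ e₂ A B 0 x = ((e₁ : ℝ) + 1) ^ 2 * (A / B * x ^ (e₁ + 1) / (x ^ (e₁ + 1) - A / B) ^ 2) := by
  have hden : x ^ (e₁ + 1) - A / B = -(A - B * x ^ (e₁ + 1)) / B := by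
    field_simp
    ring
  have hden0 : x ^ (e₁ + 1) - A / B ≠ 0 := by
    rw [hden]
    exact div_ne_zero (neg_ne_zero.2 hF) hB
  unfold rowPsi1 rowH rowU
  have hF0 : A - B * x ^ (e₁ + 1) - 0 * x ^ (e₁ + e₂ + 2) = A - B * x ^ (e₁ + 1) := by ring
  rw [hF0, hden]
  field_simp
  ring

/-! ### §2 The window transport `y = x^p` -/

/-- `(y^{1/p})^p = y` for `y ≥ 0` (`p = e₁ + 1`). [Mathlib `Real.rpow_inv_natCast_pow`] -/
theorem rpow_inv_natCast_pow' (e₁ : ℕ) {y : ℝ} (hy : 0 ≤ y) : (y ^ (((e₁ + 1 : ℕ) : ℝ)⁻¹)) ^ (e₁ + 1) = y :=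
  Real.rpow_inv_natCast_pow hy (Nat.succ_ne_zero e₁)

/-- `x ∈ (u,v)`, `0 < u` ⇒ `x^p ∈ (u^p, v^p)`. [folklore] -/
theorem pow_mem_Ioo_pow (n : ℕ) (hn : n ≠ 0) {u v x : ℝ} (hu : 0 < u) (hx : x ∈ Ioo u v) : x ^ n ∈ Ioo (u ^ n) (v ^ n) :=
  ⟨pow_lt_pow_left₀ hx.1 hu.le hn, pow_lt_pow_left₀ hx.2 (hu.le.trans hx.1.le) hn⟩

/-- `y ∈ (u^p, v^p)`, `0 < u < v` ⇒ `y^{1/p} ∈ (u, v)` and `0 < y`. [folklore] -/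
theorem rpow_inv_mem_Ioo (e₁ : ℕ) {u v y : ℝ} (hu : 0 < u) (huv : u < v) (hy : y ∈ Ioo (u ^ (e₁ + 1)) (v ^ (e₁ + 1))) :
    y ^ (((e₁ + 1 : ℕ) : ℝ)⁻¹) ∈ Ioo u v ∧ 0 < y := by
  have hp : (e₁ + 1 : ℕ) ≠ 0 := Nat.succ_ne_zero e₁
  have hpinv : 0 < (((e₁ + 1 : ℕ) : ℝ)⁻¹) := inv_pos.2 (by positivity)
  have hup : 0 < u ^ (e₁ + 1) := pow_pos hu _
  have hy0 : 0 < y := hup.trans hy.1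
  refine ⟨⟨?_, ?_⟩, hy0⟩
  · have h := Real.rpow_lt_rpow hup.le hy.1 hpinv
    rwa [Real.pow_rpow_inv_natCast hu.le hp] at h
  · have h := Real.rpow_lt_rpow hy0.le hy.2 hpinv
    rwa [Real.pow_rpow_inv_natCast (hu.le.trans huv.le) hp] at h

/-- `y ↦ y^{1/p}` is monotone on `[0, ∞)`. [Mathlib] -/
theorem rpow_inv_le_rpow_inv (e₁ : ℕ) {y₁ y₂ : ℝ} (hy₁ : 0 ≤ y₁) (h : y₁ ≤ y₂) :
    y₁ ^ (((e₁ + 1 : ℕ) : ℝ)⁻¹) ≤ y₂ ^ (((e₁ + 1 : ℕ) : ℝ)⁻¹) :=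
  Real.rpow_le_rpow hy₁ h (inv_pos.2 (by positivity)).le

/-- The derivative of `y ↦ y^{1/p}` at `y > 0` is `y^{1/p}/(p·y)`. [Mathlib `Real.hasDerivAt_rpow_const`] -/
theorem hasDerivAt_rpow_inv (e₁ : ℕ) {y : ℝ} (hy : 0 < y) :
    HasDerivAt (fun t : ℝ => t ^ (((e₁ + 1 : ℕ) : ℝ)⁻¹)) (y ^ (((e₁ + 1 : ℕ) : ℝ)⁻¹) / (((e₁ : ℝ) + 1) * y)) y := by
  have h := Real.hasDerivAt_rpow_const (p := (((e₁ + 1 : ℕ) : ℝ)⁻¹)) (Or.inl hy.ne')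
  refine h.congr_deriv ?_
  rw [Real.rpow_sub_one hy.ne']
  push_cast
  field_simp

/-! ### §3 One cloud row in the variable `y` -/

/-- **Derivative of a cloud term**: for `y > 0` with the row non-vanishing at `x = y^{1/p}`,
`d/dy [ψ₁(y^{1/p})/(p²y)] = (ψ₂ − p·ψ₁)(y^{1/p})/(p³y²)`. [this file's lemma] -/
theorem hasDerivAt_cloudTerm (e₁ e₂ : ℕ) (A B C : ℝ) {y : ℝ} (hy : 0 < y)
    (hF : A - B * (y ^ (((e₁ + 1 : ℕ) : ℝ)⁻¹)) ^ (e₁ + 1) - C * (y ^ (((e₁ + 1 : ℕ) : ℝ)⁻¹)) ^ (e₁ + e₂ + 2) ≠ 0) :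
    HasDerivAt (fun t : ℝ => rowPsi1 e₁ e₂ A B C (t ^ (((e₁ + 1 : ℕ) : ℝ)⁻¹)) / (((e₁ : ℝ) + 1) ^ 2 * t))
      ((rowPsi2 e₁ e₂ A B C (y ^ (((e₁ + 1 : ℕ) : ℝ)⁻¹))
          - ((e₁ : ℝ) + 1) * rowPsi1 e₁ e₂ A B C (y ^ (((e₁ + 1 : ℕ) : ℝ)⁻¹))) / (((e₁ : ℝ) + 1) ^ 3 * y ^ 2)) y := by
  set x : ℝ := y ^ (((e₁ + 1 : ℕ) : ℝ)⁻¹) with hxdef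
  have hx0 : 0 < x := Real.rpow_pos_of_pos hy _
  have hφ := hasDerivAt_rpow_inv e₁ hy
  have hψ : HasDerivAt (rowPsi1 e₁ e₂ A B C) (rowPsi2 e₁ e₂ A B C x / x) x := hasDerivAt_rowPsi1 e₁ e₂ A B C hx0.ne' hF
  have hcomp : HasDerivAt (fun t : ℝ => rowPsi1 e₁ e₂ A B C (t ^ (((e₁ + 1 : ℕ) : ℝ)⁻¹)))
      (rowPsi2 e₁ e₂ A B C x / x * (x / (((e₁ : ℝ) + 1) * y))) y := by
    have h := hψ.comp y hφ
    simp only [Function.comp_def] at h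
    exact h
  have hden : HasDerivAt (fun t : ℝ => ((e₁ : ℝ) + 1) ^ 2 * t) (((e₁ : ℝ) + 1) ^ 2 * 1) y := (hasDerivAt_id' y).const_mul _
  have hden0 : ((e₁ : ℝ) + 1) ^ 2 * y ≠ 0 := mul_ne_zero (by positivity) hy.ne'
  refine (hcomp.div hden hden0).congr_deriv ?_
  have hp0 : ((e₁ : ℝ) + 1) ≠ 0 := by positivity
  simp only [← hxdef]
  field_simp

/-- The cloud term's derivative is `≥ 0` wherever the monotonicity inequality `p·ψ₁ ≤ ψ₂` holds at `y^{1/p}` (`y > 0`). [this file's lemma] -/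
theorem cloudTerm_deriv_nonneg (e₁ e₂ : ℕ) (A B C : ℝ) {y : ℝ} (hy : 0 < y)
    (hM : ((e₁ : ℝ) + 1) * rowPsi1 e₁ e₂ A B C (y ^ (((e₁ + 1 : ℕ) : ℝ)⁻¹)) ≤ rowPsi2 e₁ e₂ A B C (y ^ (((e₁ + 1 : ℕ) : ℝ)⁻¹))) :
    0 ≤ (rowPsi2 e₁ e₂ A B C (y ^ (((e₁ + 1 : ℕ) : ℝ)⁻¹))
          - ((e₁ : ℝ) + 1) * rowPsi1 e₁ e₂ A B C (y ^ (((e₁ + 1 : ℕ) : ℝ)⁻¹))) / (((e₁ : ℝ) + 1) ^ 3 * y ^ 2) :=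
  div_nonneg (sub_nonneg.2 hM) (by positivity)

/-- **The x-form of convexity**: on an interval `(u,v) ⊂ (0,∞)` where the row does not vanish and `3p·ψ₂ ≤ ψ₃ + 2p²·ψ₁`,
`x ↦ (ψ₂(x) − p·ψ₁(x))/(p³x^{2p})` is non-decreasing (its derivative is `(ψ₃ − 3pψ₂ + 2p²ψ₁)/(p³x^{2p+1}) ≥ 0`). [this file's lemma] -/
theorem cloudSlope_monotoneOn (e₁ e₂ : ℕ) (A B C : ℝ) {u v : ℝ} (hu : 0 < u)
    (hF : ∀ x ∈ Ioo u v, A - B * x ^ (e₁ + 1) - C * x ^ (e₁ + e₂ + 2) ≠ 0)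
    (hCv : ∀ x ∈ Ioo u v, 3 * ((e₁ : ℝ) + 1) * rowPsi2 e₁ e₂ A B C x
      ≤ rowPsi3 e₁ e₂ A B C x + 2 * ((e₁ : ℝ) + 1) ^ 2 * rowPsi1 e₁ e₂ A B C x) :
    MonotoneOn (fun x : ℝ => (rowPsi2 e₁ e₂ A B C x - ((e₁ : ℝ) + 1) * rowPsi1 e₁ e₂ A B C x)
      / (((e₁ : ℝ) + 1) ^ 3 * x ^ (2 * (e₁ + 1)))) (Ioo u v) := by
  -- the derivative in closed form
  have hder : ∀ x ∈ Ioo u v, HasDerivAt (fun x : ℝ => (rowPsi2 e₁ e₂ A B C x - ((e₁ : ℝ) + 1) * rowPsi1 e₁ e₂ A B C x)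
      / (((e₁ : ℝ) + 1) ^ 3 * x ^ (2 * (e₁ + 1))))
      ((rowPsi3 e₁ e₂ A B C x - 3 * ((e₁ : ℝ) + 1) * rowPsi2 e₁ e₂ A B C x + 2 * ((e₁ : ℝ) + 1) ^ 2 * rowPsi1 e₁ e₂ A B C x)
        / (((e₁ : ℝ) + 1) ^ 3 * x ^ (2 * (e₁ + 1) + 1))) x := by
    intro x hx
    have hx0 : 0 < x := hu.trans hx.1
    have h1 := hasDerivAt_rowPsi1 e₁ e₂ A B C hx0.ne' (hF x hx)
    have h2 := hasDerivAt_rowPsi2 e₁ e₂ A B C hx0.ne' (hF x hx)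
    have hnum : HasDerivAt (fun x : ℝ => rowPsi2 e₁ e₂ A B C x - ((e₁ : ℝ) + 1) * rowPsi1 e₁ e₂ A B C x)
        (rowPsi3 e₁ e₂ A B C x / x - ((e₁ : ℝ) + 1) * (rowPsi2 e₁ e₂ A B C x / x)) x := h2.sub (h1.const_mul _)
    have hden : HasDerivAt (fun x : ℝ => ((e₁ : ℝ) + 1) ^ 3 * x ^ (2 * (e₁ + 1)))
        (((e₁ : ℝ) + 1) ^ 3 * (((2 * (e₁ + 1) : ℕ) : ℝ) * x ^ (2 * (e₁ + 1) - 1))) x := (hasDerivAt_pow _ x).const_mul _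
    have hden0 : ((e₁ : ℝ) + 1) ^ 3 * x ^ (2 * (e₁ + 1)) ≠ 0 := mul_ne_zero (by positivity) (pow_ne_zero _ hx0.ne')
    refine (hnum.div hden hden0).congr_deriv ?_
    have hp0 : ((e₁ : ℝ) + 1) ≠ 0 := by positivity
    have hx2 : x ^ (2 * (e₁ + 1)) = x ^ (2 * (e₁ + 1) - 1) * x := by
      calc x ^ (2 * (e₁ + 1)) = x ^ (2 * (e₁ + 1) - 1 + 1) := by
            rw [Nat.sub_add_cancel (show 1 ≤ 2 * (e₁ + 1) by omega)]
        _ = x ^ (2 * (e₁ + 1) - 1) * x := pow_succ _ _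
    have hx3 : x ^ (2 * (e₁ + 1) + 1) = x ^ (2 * (e₁ + 1) - 1) * x * x := by
      rw [pow_succ, hx2]
    rw [hx2, hx3]
    push_cast
    field_simp
    ring
  refine monotoneOn_of_deriv_nonneg (convex_Ioo u v) ?_ ?_ ?_
  · exact fun x hx => (hder x hx).continuousAt.continuousWithinAt
  · rw [interior_Ioo]
    exact fun x hx => (hder x hx).differentiableAt.differentiableWithinAt
  · rw [interior_Ioo]
    intro x hx
    rw [(hder x hx).deriv]
    have hx0 : 0 < x := hu.trans hx.1
    exact div_nonneg (by linarith [hCv x hx]) (by positivity)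

/-- **The cloud term's derivative is non-decreasing in `y`** on `(u^p, v^p)` (`0 < u < v`), given the row non-vanishing and the convexity
inequality `3p·ψ₂ ≤ ψ₃ + 2p²·ψ₁` on `(u, v)`. [this file's lemma] -/
theorem cloudTerm_deriv_monotoneOn (e₁ e₂ : ℕ) (A B C : ℝ) {u v : ℝ} (hu : 0 < u) (huv : u < v)
    (hF : ∀ x ∈ Ioo u v, A - B * x ^ (e₁ + 1) - C * x ^ (e₁ + e₂ + 2) ≠ 0)
    (hCv : ∀ x ∈ Ioo u v, 3 * ((e₁ : ℝ) + 1) * rowPsi2 e₁ e₂ A B C x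
      ≤ rowPsi3 e₁ e₂ A B C x + 2 * ((e₁ : ℝ) + 1) ^ 2 * rowPsi1 e₁ e₂ A B C x) :
    MonotoneOn (fun y : ℝ => (rowPsi2 e₁ e₂ A B C (y ^ (((e₁ + 1 : ℕ) : ℝ)⁻¹))
        - ((e₁ : ℝ) + 1) * rowPsi1 e₁ e₂ A B C (y ^ (((e₁ + 1 : ℕ) : ℝ)⁻¹))) / (((e₁ : ℝ) + 1) ^ 3 * y ^ 2))
      (Ioo (u ^ (e₁ + 1)) (v ^ (e₁ + 1))) := by
  have hmono := cloudSlope_monotoneOn e₁ e₂ A B C hu hF hCv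
  intro y₁ hy₁ y₂ hy₂ h12
  obtain ⟨hx₁, hy₁0⟩ := rpow_inv_mem_Ioo e₁ hu huv hy₁
  obtain ⟨hx₂, hy₂0⟩ := rpow_inv_mem_Ioo e₁ hu huv hy₂
  have hle := rpow_inv_le_rpow_inv e₁ hy₁0.le h12
  have key := hmono hx₁ hx₂ hle
  -- `y² = (y^{1/p})^{2p}`
  have hsq : ∀ {y : ℝ}, 0 < y → y ^ 2 = (y ^ (((e₁ + 1 : ℕ) : ℝ)⁻¹)) ^ (2 * (e₁ + 1)) := by
    intro y hy
    rw [pow_mul', rpow_inv_natCast_pow' e₁ hy.le]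
  simp only at key
  rw [← hsq hy₁0, ← hsq hy₂0] at key
  exact key

/-! ### §4 A finite cloud -/

/-- **Derivative of the cloud sum** `G(y) = Σ_{i∈T} ψ₁^{(i)}(y^{1/p})/(p²y)` at `y > 0` (no row of the cloud vanishing at `y^{1/p}`). [this file's lemma] -/
theorem hasDerivAt_cloudSum {ι : Type*} (T : Finset ι) (e₁ e₂ : ℕ) (A B C : ι → ℝ) {y : ℝ} (hy : 0 < y)
    (hF : ∀ i ∈ T, A i - B i * (y ^ (((e₁ + 1 : ℕ) : ℝ)⁻¹)) ^ (e₁ + 1) - C i * (y ^ (((e₁ + 1 : ℕ) : ℝ)⁻¹)) ^ (e₁ + e₂ + 2) ≠ 0) :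
    HasDerivAt (fun t : ℝ => ∑ i ∈ T, rowPsi1 e₁ e₂ (A i) (B i) (C i) (t ^ (((e₁ + 1 : ℕ) : ℝ)⁻¹)) / (((e₁ : ℝ) + 1) ^ 2 * t))
      (∑ i ∈ T, (rowPsi2 e₁ e₂ (A i) (B i) (C i) (y ^ (((e₁ + 1 : ℕ) : ℝ)⁻¹))
          - ((e₁ : ℝ) + 1) * rowPsi1 e₁ e₂ (A i) (B i) (C i) (y ^ (((e₁ + 1 : ℕ) : ℝ)⁻¹))) / (((e₁ : ℝ) + 1) ^ 3 * y ^ 2)) y :=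
  HasDerivAt.fun_sum fun i hi => hasDerivAt_cloudTerm e₁ e₂ (A i) (B i) (C i) hy (hF i hi)

/-- The cloud sum's derivative is `≥ 0` given `p·ψ₁ ≤ ψ₂` row by row at `y^{1/p}`. [this file's lemma] -/
theorem cloudSum_deriv_nonneg {ι : Type*} (T : Finset ι) (e₁ e₂ : ℕ) (A B C : ι → ℝ) {y : ℝ} (hy : 0 < y)
    (hM : ∀ i ∈ T, ((e₁ : ℝ) + 1) * rowPsi1 e₁ e₂ (A i) (B i) (C i) (y ^ (((e₁ + 1 : ℕ) : ℝ)⁻¹))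
      ≤ rowPsi2 e₁ e₂ (A i) (B i) (C i) (y ^ (((e₁ + 1 : ℕ) : ℝ)⁻¹))) :
    0 ≤ ∑ i ∈ T, (rowPsi2 e₁ e₂ (A i) (B i) (C i) (y ^ (((e₁ + 1 : ℕ) : ℝ)⁻¹))
          - ((e₁ : ℝ) + 1) * rowPsi1 e₁ e₂ (A i) (B i) (C i) (y ^ (((e₁ + 1 : ℕ) : ℝ)⁻¹))) / (((e₁ : ℝ) + 1) ^ 3 * y ^ 2) :=
  Finset.sum_nonneg fun i hi => cloudTerm_deriv_nonneg e₁ e₂ (A i) (B i) (C i) hy (hM i hi)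

/-- **The cloud sum's derivative is non-decreasing** on `(u^p, v^p)` (`0 < u < v`), given non-vanishing and `3p·ψ₂ ≤ ψ₃ + 2p²·ψ₁` row by row
on `(u,v)`. [this file's lemma] -/
theorem cloudSum_deriv_monotoneOn {ι : Type*} (T : Finset ι) (e₁ e₂ : ℕ) (A B C : ι → ℝ) {u v : ℝ} (hu : 0 < u) (huv : u < v)
    (hF : ∀ i ∈ T, ∀ x ∈ Ioo u v, A i - B i * x ^ (e₁ + 1) - C i * x ^ (e₁ + e₂ + 2) ≠ 0)
    (hCv : ∀ i ∈ T, ∀ x ∈ Ioo u v, 3 * ((e₁ : ℝ) + 1) * rowPsi2 e₁ e₂ (A i) (B i) (C i) x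
      ≤ rowPsi3 e₁ e₂ (A i) (B i) (C i) x + 2 * ((e₁ : ℝ) + 1) ^ 2 * rowPsi1 e₁ e₂ (A i) (B i) (C i) x) :
    MonotoneOn (fun y : ℝ => ∑ i ∈ T, (rowPsi2 e₁ e₂ (A i) (B i) (C i) (y ^ (((e₁ + 1 : ℕ) : ℝ)⁻¹))
        - ((e₁ : ℝ) + 1) * rowPsi1 e₁ e₂ (A i) (B i) (C i) (y ^ (((e₁ + 1 : ℕ) : ℝ)⁻¹))) / (((e₁ : ℝ) + 1) ^ 3 * y ^ 2))
      (Ioo (u ^ (e₁ + 1)) (v ^ (e₁ + 1))) := by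
  intro y₁ hy₁ y₂ hy₂ h12
  exact Finset.sum_le_sum fun i hi => cloudTerm_deriv_monotoneOn e₁ e₂ (A i) (B i) (C i) hu huv (hF i hi) (hCv i hi) hy₁ hy₂ h12

end ProductPlusOne

end Summit.ValiantsHypothesis.ValiantsHypothesis.Theorems.LacunarySymmetroidMatrixDescartes
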